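import Summits.QuantumFields.BalabanUV.Beta.GAN24.ContactCauchyCells

/-!
# `BalabanUV.Beta.GAN24.ContactCauchyAssembly` — binder row G-an2-4 / (CONV-C), the row owner's CONTACT-TERM ROUTE, **CT-4e part 2** (`gen19/CT4-DESIGN-v0.md` §3
# «`ContactCauchyAssembly` — Owner»; design decision D-g22-1, journal [GAN24P1-G22-ONLINE]: SUP-RATE CURRENCY): **THE CONTACT TERM OF THE CUBIC-WILSON SECTOR,
# DIFFERENCED ACROSS TWO CONSECUTIVE TOP-ALIGNED TOWERS IN TABLE UNITS, IS `ϑ^k`-SMALL IN SUP NORM** — from the five two-tower atom ENDs of CT-4c (leaf-02 g50's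
# B-atoms `ContactRefineBHolds.exists_atomTip∕Mid∕Site_refine_three`, gan24-p2 g34's P-atoms `ContactRefinePThreePack.exists_pairingAtomTip∕Mid_refine_three`),
# taken here as HYPOTHESES of their exact ∃-shapes (B6 `unitVec` spelling) so that this file lands independently of their filing order.

NOT IN PRINT; OUR BOOKKEEPING (row owner `b2b-balaban-gan24-p1`, gen 22).  [folklore]: part 1's identity `ContactCauchyCells.contact_eq_atoms` at `k` and `k+1`,
the triangle inequality over the nine atom groups of the three cells, `e^{−(κ∕12)·spread} ≤ 1`, and ONE rate `ϑ = max` of the five suppliers' rates.  HONEST FRAMING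
(cell contract, verbatim): «discharging `BetaPertH` makes Bałaban's UV stability UNCONDITIONAL — a real constructive-QFT result; it is NOT the continuum limit and NOT
the Clay problem.»  HONEST DEPENDENCY (verbatim): «continuum YM on T⁴ ⇐ BetaPertH ∧ nine spine estimates (0/9 proved); BetaPertH ⇐ (D1) ∧ (D4) ∧ CAP+tail; G-an2-4
gates asym, D1 and NE2/3/4.»  0 `def`, 0 cited facts, 0 `def … : Prop`, 0 sorry.  NO estimate of Bałaban's; CONDITIONAL on the five atom ENDs (hypotheses `hTip hMid
hSite hPT hPM`; the one-line discharge `exists_contact_supRate_three` follows their landing); discharges NOTHING of (hS, hSall) on (E) by itself (part 3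
`WilsonSectorRate` adds road S3's undressed difference row and interpolates against hS0); 0 wall binders; NEVER «G-an2-4 closed» as (CONV-C); NOT D1, NOT
BetaPertH, NOT continuum, NOT Clay.

## What is proved
* §1 [folklore] real bookkeeping: `abs_comb_le` (the nine-group triangle inequality of the three cells' signed combination), `abs_mul_sum_sub_le` (a scaled sum
  differenced term by term), `pow_pow_twelve` (`(Lc^m)^12 = Lc^{12m}`), `exp_spread_le_one`.
* §2 (`d = 3`, `2 ≤ Lc`) **`exists_contact_supRate_of_atoms`**: the five atom ENDs ⟹ `∃ K ϑ, 0 ≤ K ∧ 0 ≤ ϑ ∧ ϑ < 1 ∧` for every in-block root `rr`, every `k`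
  and all coarse data `κ′ u′ x′ z′ α β`,
  `|Lc^{12(k+2)}·(push₃ T′³ W − push₃ B′³ W) − Lc^{12(k+1)}·(push₃ T³ W − push₃ B³ W)| (κ′ u′ x′ z′ (inl α) (inl β)) ≤ K·ϑ^k`
  (`T′ = legChain (respStepBmSeq ρ Lc) 0 (k+1)`, `B′ = respStep 1 (Lc^(k+2))`, `T = legChain … 0 k`, `B = respStep 1 (Lc^(k+1))`, `W = wilsonA 3`).
Unit `b2b-balaban-gan24-p1` (row owner G-an2-4, gen 22), 2026-08-21.
-/

noncomputable section

open Finset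
open scoped BigOperators
open Literature.MathematicalPhysics.QuantumFieldTheory
open Literature.MathematicalPhysics.QuantumFieldTheory.LatticeForm (quo)
open Literature.MathematicalPhysics.QuantumFieldTheory.Balaban1983to89
open Literature.MathematicalPhysics.QuantumFieldTheory.Balaban1983to89.Beta
open B4ContourShift (supNorm supNorm_nonneg)
open ExpKernelCalculus (Zl Zl_nonneg)
open StepJetData (wilsonA)
open AffineAveraging (Form0 Form1 Site box toSite curv curvAdj)
open AffineReproduction (contourSumAdj)
open KernelSpecInstance (wΦ)
open B6BondElimination (unitVec)
open KKTFluctuationKernel (delta1)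
open BalabanCompositeJets (respStep)
open Summit.QuantumFields.BalabanUV.Beta.AxialProjectorBlockMean (bmGaugeAt)
open Summit.QuantumFields.BalabanUV.Beta.GAN24.Push4Iter (LegFam legChain)
open Summit.QuantumFields.BalabanUV.Beta.GAN24.RespStepBmDecompExact (respStepBmSeq)
open Summit.QuantumFields.BalabanUV.Beta.GAN24.RespStepBmDecompPsi (Psi)
open Summit.QuantumFields.BalabanUV.Beta.GAN24.Push3 (push₃)
open Summit.QuantumFields.BalabanUV.Beta.GAN24.ContactCauchyCells (contact_eq_atoms)

namespace Summit.QuantumFields.BalabanUV.Beta.GAN24.ContactCauchyAssembly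

/-! ## §1 Real bookkeeping -/

/-- [folklore] **THE NINE-GROUP TRIANGLE INEQUALITY** of the three cells' signed combination, scaled and differenced:
`|c′·CT′ − c·CT| ≤ ½·Σ_{nine groups} |c′·X′ − c·X|`. -/
theorem abs_comb_le (c c' A1 A1' PA PA' B1 B1' PB PB' A2 A2' PC PC' B2 B2' S1 S1' S2 S2' : ℝ) :
    |c' * (((1 / 2 : ℝ) * (A1' + PA') - (1 / 2 : ℝ) * (B1' + PB')) - ((1 / 2 : ℝ) * (A2' + PC') - (1 / 2 : ℝ) * B2')
        + ((1 / 2 : ℝ) * S1' - (1 / 2 : ℝ) * S2'))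
      - c * (((1 / 2 : ℝ) * (A1 + PA) - (1 / 2 : ℝ) * (B1 + PB)) - ((1 / 2 : ℝ) * (A2 + PC) - (1 / 2 : ℝ) * B2)
        + ((1 / 2 : ℝ) * S1 - (1 / 2 : ℝ) * S2))|
      ≤ (1 / 2 : ℝ) * (|c' * A1' - c * A1| + |c' * PA' - c * PA| + |c' * B1' - c * B1| + |c' * PB' - c * PB|
          + |c' * A2' - c * A2| + |c' * PC' - c * PC| + |c' * B2' - c * B2| + |c' * S1' - c * S1| + |c' * S2' - c * S2|) := by
  have e : c' * (((1 / 2 : ℝ) * (A1' + PA') - (1 / 2 : ℝ) * (B1' + PB')) - ((1 / 2 : ℝ) * (A2' + PC') - (1 / 2 : ℝ) * B2')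
        + ((1 / 2 : ℝ) * S1' - (1 / 2 : ℝ) * S2'))
      - c * (((1 / 2 : ℝ) * (A1 + PA) - (1 / 2 : ℝ) * (B1 + PB)) - ((1 / 2 : ℝ) * (A2 + PC) - (1 / 2 : ℝ) * B2)
        + ((1 / 2 : ℝ) * S1 - (1 / 2 : ℝ) * S2))
      = (1 / 2 : ℝ) * ((c' * A1' - c * A1) + (c' * PA' - c * PA) - (c' * B1' - c * B1) - (c' * PB' - c * PB)
          - (c' * A2' - c * A2) - (c' * PC' - c * PC) + (c' * B2' - c * B2) + (c' * S1' - c * S1) - (c' * S2' - c * S2)) := by ring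
  rw [e, abs_mul, abs_of_pos (by norm_num : (0 : ℝ) < 1 / 2)]
  refine mul_le_mul_of_nonneg_left ?_ (by norm_num)
  set y₁ := c' * A1' - c * A1
  set y₂ := c' * PA' - c * PA
  set y₃ := c' * B1' - c * B1
  set y₄ := c' * PB' - c * PB
  set y₅ := c' * A2' - c * A2
  set y₆ := c' * PC' - c * PC
  set y₇ := c' * B2' - c * B2
  set y₈ := c' * S1' - c * S1
  set y₉ := c' * S2' - c * S2
  rw [abs_le]
  constructor
  · linarith [neg_abs_le y₁, neg_abs_le y₂, neg_abs_le y₃, neg_abs_le y₄, neg_abs_le y₅, neg_abs_le y₆, neg_abs_le y₇, neg_abs_le y₈,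
      neg_abs_le y₉, le_abs_self y₁, le_abs_self y₂, le_abs_self y₃, le_abs_self y₄, le_abs_self y₅, le_abs_self y₆, le_abs_self y₇,
      le_abs_self y₈, le_abs_self y₉]
  · linarith [neg_abs_le y₁, neg_abs_le y₂, neg_abs_le y₃, neg_abs_le y₄, neg_abs_le y₅, neg_abs_le y₆, neg_abs_le y₇, neg_abs_le y₈,
      neg_abs_le y₉, le_abs_self y₁, le_abs_self y₂, le_abs_self y₃, le_abs_self y₄, le_abs_self y₅, le_abs_self y₆, le_abs_self y₇,
      le_abs_self y₈, le_abs_self y₉]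

/-- [folklore] **A SCALED FINITE SUM, DIFFERENCED TERM BY TERM**: `|c′·Σ_i P′ i − c·Σ_i P i| ≤ #s · b` from `|c′·P′ i − c·P i| ≤ b`. -/
theorem abs_mul_sum_sub_le {ι : Type*} (s : Finset ι) (c c' : ℝ) (P P' : ι → ℝ) {b : ℝ} (h : ∀ i ∈ s, |c' * P' i - c * P i| ≤ b) :
    |c' * ∑ i ∈ s, P' i - c * ∑ i ∈ s, P i| ≤ (s.card : ℝ) * b := by
  rw [Finset.mul_sum, Finset.mul_sum, ← Finset.sum_sub_distrib]
  refine (Finset.abs_sum_le_sum_abs _ _).trans ((Finset.sum_le_sum h).trans ?_)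
  rw [Finset.sum_const, nsmul_eq_mul]

/-- [folklore] `(Lc^m)^12 = Lc^{12m}` (the B-atom ENDs' table currency against ours). -/
theorem pow_pow_twelve (Lc : ℕ) (m : ℕ) : ((Lc : ℝ) ^ m) ^ 12 = (Lc : ℝ) ^ (12 * m) := by
  rw [← pow_mul, mul_comm]

/-- [folklore] An envelope exponential is at most one: `e^{−(κ∕12)(‖a‖∞ + ‖b‖∞)} ≤ 1` for `κ ≥ 0`. -/
theorem exp_spread_le_one {κ : ℝ} (hκ : 0 ≤ κ) (a b : Site (3 + 1)) : Real.exp (-(κ / 12) * (supNorm a + supNorm b)) ≤ 1 := by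
  rw [Real.exp_le_one_iff]
  have ha := supNorm_nonneg a
  have hb := supNorm_nonneg b
  nlinarith

/-! ## §2 The contact term differenced across two towers, sup currency (`d = 3`) -/

section Three

variable {Lc : ℕ} [NeZero Lc]

/-- NOT IN PRINT; OUR BOOKKEEPING.  **CT-4e — THE CONTACT TERM DIFFERENCED ACROSS TWO CONSECUTIVE TOP-ALIGNED TOWERS IS `ϑ^k`-SMALL IN TABLE UNITS, SUP NORM**
(`d = 3`, `2 ≤ Lc`), CONDITIONAL on the five two-tower atom ENDs of CT-4c in their exact ∃-shapes (B6 `unitVec`): `hTip`, `hMid`, `hSite` (leaf-02 g50's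
`ContactRefineBHolds.exists_atomTip∕Mid∕Site_refine_three`), `hPT`, `hPM` (gan24-p2 g34's `ContactRefinePThreePack.exists_pairingAtomTip∕Mid_refine_three`, their
`AffineAveraging.unitVec` respelled by leaf-02's `affine_unitVec_eq`).  THEN `∃ K ≥ 0, ϑ ∈ [0,1)` with, for every in-block root, every `k` and all coarse data,
`|Lc^{12(k+2)}·CT_{k+1} − Lc^{12(k+1)}·CT_k| ≤ K·ϑ^k`, `CT_k = push₃ T³ (wilsonA 3) − push₃ B³ (wilsonA 3)` at `κ′ u′ x′ z′ (inl α) (inl β)`. -/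
theorem exists_contact_supRate_of_atoms (hLc : 2 ≤ Lc)
    (hTip : ∃ κ K ϑ : ℝ, 0 < κ ∧ 0 ≤ K ∧ 0 ≤ ϑ ∧ ϑ < 1 ∧
      ∀ (rr : Fin (3 + 1) → ℕ), rr ∈ box (3 + 1) Lc →
        ∀ (k : ℕ) (κ' : Fin (3 + 1)) (u' : Site (3 + 1)) (α : Fin (3 + 1)) (x' : Site (3 + 1)) (β : Fin (3 + 1)) (z' : Site (3 + 1)),
          |((Lc : ℝ) ^ (k + 2)) ^ 12 *
          (∑' x : Site (3 + 1), ∑ κ,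
            (Psi (toSite rr) Lc 0 (k + 1) (delta1 α x') - bmGaugeAt (toSite rr) (respStep (d := 3) 1 (Lc ^ (k + 2)) α x') Lc) (x + unitVec κ)
              * respStep (d := 3) 1 (Lc ^ (k + 2)) κ' u' κ x
              * contourSumAdj (Lc ^ (k + 2)) (fun l y => wΦ (N := Lc ^ (k + 2)) (d := 3) l β (y - z')) κ x)
          - ((Lc : ℝ) ^ (k + 1)) ^ 12 *
          (∑' cc : Site (3 + 1), ∑ κ,
            (Psi (toSite rr) Lc 0 k (delta1 α x') - bmGaugeAt (toSite rr) (respStep (d := 3) 1 (Lc ^ (k + 1)) α x') Lc) (cc + unitVec κ)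
              * respStep (d := 3) 1 (Lc ^ (k + 1)) κ' u' κ cc
              * contourSumAdj (Lc ^ (k + 1)) (fun l y => wΦ (N := Lc ^ (k + 1)) (d := 3) l β (y - z')) κ cc)|
          ≤ K * ϑ ^ k * (Zl (3 + 1) (κ / (4 * ((((3 : ℕ) : ℝ)) + 1))) * Real.exp (-(κ / 12) * (supNorm (u' - x') + supNorm (z' - x')))))
    (hMid : ∃ κ K ϑ : ℝ, 0 < κ ∧ 0 ≤ K ∧ 0 ≤ ϑ ∧ ϑ < 1 ∧
      ∀ (rr : Fin (3 + 1) → ℕ), rr ∈ box (3 + 1) Lc →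
        ∀ (k : ℕ) (κ' : Fin (3 + 1)) (u' : Site (3 + 1)) (α : Fin (3 + 1)) (x' : Site (3 + 1)) (β : Fin (3 + 1)) (z' : Site (3 + 1)),
          |((Lc : ℝ) ^ (k + 2)) ^ 12 *
          (∑' x : Site (3 + 1), ∑ κ,
            ((Psi (toSite rr) Lc 0 (k + 1) (delta1 α x') - bmGaugeAt (toSite rr) (respStep (d := 3) 1 (Lc ^ (k + 2)) α x') Lc) x
              + (Psi (toSite rr) Lc 0 (k + 1) (delta1 α x') - bmGaugeAt (toSite rr) (respStep (d := 3) 1 (Lc ^ (k + 2)) α x') Lc) (x + unitVec κ)) / 2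
              * respStep (d := 3) 1 (Lc ^ (k + 2)) κ' u' κ x
              * contourSumAdj (Lc ^ (k + 2)) (fun l y => wΦ (N := Lc ^ (k + 2)) (d := 3) l β (y - z')) κ x)
          - ((Lc : ℝ) ^ (k + 1)) ^ 12 *
          (∑' cc : Site (3 + 1), ∑ κ,
            ((Psi (toSite rr) Lc 0 k (delta1 α x') - bmGaugeAt (toSite rr) (respStep (d := 3) 1 (Lc ^ (k + 1)) α x') Lc) cc
              + (Psi (toSite rr) Lc 0 k (delta1 α x') - bmGaugeAt (toSite rr) (respStep (d := 3) 1 (Lc ^ (k + 1)) α x') Lc) (cc + unitVec κ)) / 2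
              * respStep (d := 3) 1 (Lc ^ (k + 1)) κ' u' κ cc
              * contourSumAdj (Lc ^ (k + 1)) (fun l y => wΦ (N := Lc ^ (k + 1)) (d := 3) l β (y - z')) κ cc)|
          ≤ K * ϑ ^ k * (Zl (3 + 1) (κ / (4 * ((((3 : ℕ) : ℝ)) + 1))) * Real.exp (-(κ / 12) * (supNorm (u' - x') + supNorm (z' - x')))))
    (hSite : ∃ κ K ϑ : ℝ, 0 < κ ∧ 0 ≤ K ∧ 0 ≤ ϑ ∧ ϑ < 1 ∧
      ∀ (rr : Fin (3 + 1) → ℕ), rr ∈ box (3 + 1) Lc →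
        ∀ (k : ℕ) (κ' : Fin (3 + 1)) (u' : Site (3 + 1)) (α : Fin (3 + 1)) (x' : Site (3 + 1)) (β : Fin (3 + 1)) (z' : Site (3 + 1)),
          |((Lc : ℝ) ^ (k + 2)) ^ 12 *
          (∑' x : Site (3 + 1), ∑ κ,
            (Psi (toSite rr) Lc 0 (k + 1) (delta1 α x') - bmGaugeAt (toSite rr) (respStep (d := 3) 1 (Lc ^ (k + 2)) α x') Lc) x
              * respStep (d := 3) 1 (Lc ^ (k + 2)) κ' u' κ x
              * contourSumAdj (Lc ^ (k + 2)) (fun l y => wΦ (N := Lc ^ (k + 2)) (d := 3) l β (y - z')) κ x)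
          - ((Lc : ℝ) ^ (k + 1)) ^ 12 *
          (∑' cc : Site (3 + 1), ∑ κ,
            (Psi (toSite rr) Lc 0 k (delta1 α x') - bmGaugeAt (toSite rr) (respStep (d := 3) 1 (Lc ^ (k + 1)) α x') Lc) cc
              * respStep (d := 3) 1 (Lc ^ (k + 1)) κ' u' κ cc
              * contourSumAdj (Lc ^ (k + 1)) (fun l y => wΦ (N := Lc ^ (k + 1)) (d := 3) l β (y - z')) κ cc)|
          ≤ K * ϑ ^ k * (Zl (3 + 1) (κ / (4 * ((((3 : ℕ) : ℝ)) + 1))) * Real.exp (-(κ / 12) * (supNorm (u' - x') + supNorm (z' - x')))))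
    (hPT : ∃ κ₀ K θP : ℝ, 0 < κ₀ ∧ 0 ≤ K ∧ 0 ≤ θP ∧ θP < 1 ∧
      ∀ (rr : Fin (3 + 1) → ℕ), rr ∈ box (3 + 1) Lc →
        ∀ (k : ℕ) (μt : Fin (3 + 1)) (zt : Site (3 + 1)) (μ₁ : Fin (3 + 1)) (z₁ : Site (3 + 1)) (μ₂ : Fin (3 + 1)) (z₂ : Site (3 + 1))
          (κ : Fin (3 + 1)),
          |(Lc : ℝ) ^ (12 * (k + 2)) * (∑' v : Site (3 + 1), contourSumAdj (Lc ^ (k + 2)) (fun κ' y => wΦ (N := Lc ^ (k + 2)) κ' μt (y - zt)) κ v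
            * (Psi (toSite rr) Lc 0 (k + 1) (delta1 μ₁ z₁) (v + unitVec κ) - bmGaugeAt (toSite rr) (respStep (d := 3) 1 (Lc ^ (k + 2)) μ₁ z₁) Lc (v + unitVec κ))
            * ((Psi (toSite rr) Lc 0 (k + 1) (delta1 μ₂ z₂) (v + unitVec κ) - bmGaugeAt (toSite rr) (respStep (d := 3) 1 (Lc ^ (k + 2)) μ₂ z₂) Lc (v + unitVec κ))
              - (Psi (toSite rr) Lc 0 (k + 1) (delta1 μ₂ z₂) v - bmGaugeAt (toSite rr) (respStep (d := 3) 1 (Lc ^ (k + 2)) μ₂ z₂) Lc v)))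
            - (Lc : ℝ) ^ (12 * (k + 1)) * (∑' w : Site (3 + 1), contourSumAdj (Lc ^ (k + 1)) (fun κ' y => wΦ (N := Lc ^ (k + 1)) κ' μt (y - zt)) κ w
            * (Psi (toSite rr) Lc 0 k (delta1 μ₁ z₁) (w + unitVec κ) - bmGaugeAt (toSite rr) (respStep (d := 3) 1 (Lc ^ (k + 1)) μ₁ z₁) Lc (w + unitVec κ))
            * ((Psi (toSite rr) Lc 0 k (delta1 μ₂ z₂) (w + unitVec κ) - bmGaugeAt (toSite rr) (respStep (d := 3) 1 (Lc ^ (k + 1)) μ₂ z₂) Lc (w + unitVec κ))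
              - (Psi (toSite rr) Lc 0 k (delta1 μ₂ z₂) w - bmGaugeAt (toSite rr) (respStep (d := 3) 1 (Lc ^ (k + 1)) μ₂ z₂) Lc w)))|
            ≤ K * θP ^ k * Real.exp (-(κ₀ / 12) * (supNorm (z₁ - zt) + supNorm (z₂ - zt))))
    (hPM : ∃ κ₀ K θP : ℝ, 0 < κ₀ ∧ 0 ≤ K ∧ 0 ≤ θP ∧ θP < 1 ∧
      ∀ (rr : Fin (3 + 1) → ℕ), rr ∈ box (3 + 1) Lc →
        ∀ (k : ℕ) (μt : Fin (3 + 1)) (zt : Site (3 + 1)) (μ₁ : Fin (3 + 1)) (z₁ : Site (3 + 1)) (μ₂ : Fin (3 + 1)) (z₂ : Site (3 + 1))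
          (κ : Fin (3 + 1)),
          |(Lc : ℝ) ^ (12 * (k + 2)) * (∑' v : Site (3 + 1), contourSumAdj (Lc ^ (k + 2)) (fun κ' y => wΦ (N := Lc ^ (k + 2)) κ' μt (y - zt)) κ v
            * (((Psi (toSite rr) Lc 0 (k + 1) (delta1 μ₁ z₁) v - bmGaugeAt (toSite rr) (respStep (d := 3) 1 (Lc ^ (k + 2)) μ₁ z₁) Lc v)
              + (Psi (toSite rr) Lc 0 (k + 1) (delta1 μ₁ z₁) (v + unitVec κ) - bmGaugeAt (toSite rr) (respStep (d := 3) 1 (Lc ^ (k + 2)) μ₁ z₁) Lc (v + unitVec κ))) / 2)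
            * ((Psi (toSite rr) Lc 0 (k + 1) (delta1 μ₂ z₂) (v + unitVec κ) - bmGaugeAt (toSite rr) (respStep (d := 3) 1 (Lc ^ (k + 2)) μ₂ z₂) Lc (v + unitVec κ))
              - (Psi (toSite rr) Lc 0 (k + 1) (delta1 μ₂ z₂) v - bmGaugeAt (toSite rr) (respStep (d := 3) 1 (Lc ^ (k + 2)) μ₂ z₂) Lc v)))
            - (Lc : ℝ) ^ (12 * (k + 1)) * (∑' w : Site (3 + 1), contourSumAdj (Lc ^ (k + 1)) (fun κ' y => wΦ (N := Lc ^ (k + 1)) κ' μt (y - zt)) κ w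
            * (((Psi (toSite rr) Lc 0 k (delta1 μ₁ z₁) w - bmGaugeAt (toSite rr) (respStep (d := 3) 1 (Lc ^ (k + 1)) μ₁ z₁) Lc w)
              + (Psi (toSite rr) Lc 0 k (delta1 μ₁ z₁) (w + unitVec κ) - bmGaugeAt (toSite rr) (respStep (d := 3) 1 (Lc ^ (k + 1)) μ₁ z₁) Lc (w + unitVec κ))) / 2)
            * ((Psi (toSite rr) Lc 0 k (delta1 μ₂ z₂) (w + unitVec κ) - bmGaugeAt (toSite rr) (respStep (d := 3) 1 (Lc ^ (k + 1)) μ₂ z₂) Lc (w + unitVec κ))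
              - (Psi (toSite rr) Lc 0 k (delta1 μ₂ z₂) w - bmGaugeAt (toSite rr) (respStep (d := 3) 1 (Lc ^ (k + 1)) μ₂ z₂) Lc w)))|
            ≤ K * θP ^ k * Real.exp (-(κ₀ / 12) * (supNorm (z₁ - zt) + supNorm (z₂ - zt)))) :
    ∃ K ϑ : ℝ, 0 ≤ K ∧ 0 ≤ ϑ ∧ ϑ < 1 ∧ ∀ (rr : Fin (3 + 1) → ℕ), rr ∈ box (3 + 1) Lc →
      ∀ (k : ℕ) (κ₁ : Fin (3 + 1)) (u' x' z' : Site (3 + 1)) (α β : Fin (3 + 1)),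
        |(Lc : ℝ) ^ (12 * (k + 2)) *
            (push₃ (legChain (respStepBmSeq (d := 3) (toSite rr) Lc) 0 (k + 1)) (legChain (respStepBmSeq (d := 3) (toSite rr) Lc) 0 (k + 1))
                (legChain (respStepBmSeq (d := 3) (toSite rr) Lc) 0 (k + 1)) (wilsonA 3) κ₁ u' x' z' (Sum.inl α) (Sum.inl β)
              - push₃ (respStep (d := 3) 1 (Lc ^ (k + 2))) (respStep (d := 3) 1 (Lc ^ (k + 2))) (respStep (d := 3) 1 (Lc ^ (k + 2)))
                (wilsonA 3) κ₁ u' x' z' (Sum.inl α) (Sum.inl β))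
          - (Lc : ℝ) ^ (12 * (k + 1)) *
            (push₃ (legChain (respStepBmSeq (d := 3) (toSite rr) Lc) 0 k) (legChain (respStepBmSeq (d := 3) (toSite rr) Lc) 0 k)
                (legChain (respStepBmSeq (d := 3) (toSite rr) Lc) 0 k) (wilsonA 3) κ₁ u' x' z' (Sum.inl α) (Sum.inl β)
              - push₃ (respStep (d := 3) 1 (Lc ^ (k + 1))) (respStep (d := 3) 1 (Lc ^ (k + 1))) (respStep (d := 3) 1 (Lc ^ (k + 1)))
                (wilsonA 3) κ₁ u' x' z' (Sum.inl α) (Sum.inl β))|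
          ≤ K * ϑ ^ k := by
  obtain ⟨κ₁, K₁, ϑ₁, hκ₁, hK₁, hϑ₁0, hϑ₁1, hT⟩ := hTip
  obtain ⟨κ₂, K₂, ϑ₂, hκ₂, hK₂, hϑ₂0, hϑ₂1, hM⟩ := hMid
  obtain ⟨κ₃, K₃, ϑ₃, hκ₃, hK₃, hϑ₃0, hϑ₃1, hS⟩ := hSite
  obtain ⟨κ₄, K₄, ϑ₄, hκ₄, hK₄, hϑ₄0, hϑ₄1, hPt⟩ := hPT
  obtain ⟨κ₅, K₅, ϑ₅, hκ₅, hK₅, hϑ₅0, hϑ₅1, hPm⟩ := hPM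
  -- one rate
  set ϑ : ℝ := max (max (max ϑ₁ ϑ₂) (max ϑ₃ ϑ₄)) ϑ₅ with hϑ
  have h1 : ϑ₁ ≤ ϑ := ((le_max_left _ _).trans (le_max_left _ _)).trans (le_max_left _ _)
  have h2 : ϑ₂ ≤ ϑ := ((le_max_right _ _).trans (le_max_left _ _)).trans (le_max_left _ _)
  have h3 : ϑ₃ ≤ ϑ := ((le_max_left _ _).trans (le_max_right _ _)).trans (le_max_left _ _)
  have h4 : ϑ₄ ≤ ϑ := ((le_max_right _ _).trans (le_max_right _ _)).trans (le_max_left _ _)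
  have h5 : ϑ₅ ≤ ϑ := le_max_right _ _
  have hϑ0 : 0 ≤ ϑ := hϑ₅0.trans h5
  have hϑ1 : ϑ < 1 := max_lt (max_lt (max_lt hϑ₁1 hϑ₂1) (max_lt hϑ₃1 hϑ₄1)) hϑ₅1
  -- the envelope constants
  set Z₁ : ℝ := Zl (3 + 1) (κ₁ / (4 * ((((3 : ℕ) : ℝ)) + 1))) with hZ₁
  set Z₂ : ℝ := Zl (3 + 1) (κ₂ / (4 * ((((3 : ℕ) : ℝ)) + 1))) with hZ₂
  set Z₃ : ℝ := Zl (3 + 1) (κ₃ / (4 * ((((3 : ℕ) : ℝ)) + 1))) with hZ₃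
  have hZ₁0 : 0 ≤ Z₁ := Zl_nonneg (by positivity)
  have hZ₂0 : 0 ≤ Z₂ := Zl_nonneg (by positivity)
  have hZ₃0 : 0 ≤ Z₃ := Zl_nonneg (by positivity)
  set K : ℝ := (1 / 2 : ℝ) * (K₁ * Z₁ + 4 * K₄ + K₂ * Z₂ + 4 * K₅ + K₁ * Z₁ + 4 * K₄ + K₂ * Z₂ + K₃ * Z₃ + K₃ * Z₃) with hK
  refine ⟨K, ϑ, by positivity, hϑ0, hϑ1, fun rr hrr k κ₁' u' x' z' α β => ?_⟩
  -- the geometric step of each supplier against the common rate, envelopes bounded by one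
  have geo : ∀ {θ K' Z E : ℝ}, 0 ≤ θ → θ ≤ ϑ → 0 ≤ K' → 0 ≤ Z → E ≤ 1 → 0 ≤ E → K' * θ ^ k * (Z * E) ≤ K' * Z * ϑ ^ k := by
    intro θ K' Z E hθ0 hθ hK' hZ hE hE0
    have hp : θ ^ k ≤ ϑ ^ k := pow_le_pow_left₀ hθ0 hθ k
    have hp0 : 0 ≤ θ ^ k := pow_nonneg hθ0 k
    calc K' * θ ^ k * (Z * E) ≤ K' * θ ^ k * (Z * 1) := by gcongr
      _ = K' * Z * θ ^ k := by ring
      _ ≤ K' * Z * ϑ ^ k := mul_le_mul_of_nonneg_left hp (mul_nonneg hK' hZ)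
  have geoP : ∀ {θ K' E : ℝ}, 0 ≤ θ → θ ≤ ϑ → 0 ≤ K' → E ≤ 1 → 0 ≤ E → K' * θ ^ k * E ≤ K' * ϑ ^ k := by
    intro θ K' E hθ0 hθ hK' hE hE0
    have hp : θ ^ k ≤ ϑ ^ k := pow_le_pow_left₀ hθ0 hθ k
    have hp0 : 0 ≤ θ ^ k := pow_nonneg hθ0 k
    calc K' * θ ^ k * E ≤ K' * θ ^ k * 1 := by gcongr
      _ = K' * θ ^ k := by ring
      _ ≤ K' * ϑ ^ k := mul_le_mul_of_nonneg_left hp hK'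
  -- the B-atom letters in our currency
  have bT : ∀ (κ' : Fin (3 + 1)) (u' : Site (3 + 1)) (α : Fin (3 + 1)) (x' : Site (3 + 1)) (β : Fin (3 + 1)) (z' : Site (3 + 1)),
      |(Lc : ℝ) ^ (12 * (k + 2)) *
          (∑' x : Site (3 + 1), ∑ κ,
            (Psi (toSite rr) Lc 0 (k + 1) (delta1 α x') - bmGaugeAt (toSite rr) (respStep (d := 3) 1 (Lc ^ (k + 2)) α x') Lc) (x + unitVec κ)
              * respStep (d := 3) 1 (Lc ^ (k + 2)) κ' u' κ x
              * contourSumAdj (Lc ^ (k + 2)) (fun l y => wΦ (N := Lc ^ (k + 2)) (d := 3) l β (y - z')) κ x)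
          - (Lc : ℝ) ^ (12 * (k + 1)) *
          (∑' cc : Site (3 + 1), ∑ κ,
            (Psi (toSite rr) Lc 0 k (delta1 α x') - bmGaugeAt (toSite rr) (respStep (d := 3) 1 (Lc ^ (k + 1)) α x') Lc) (cc + unitVec κ)
              * respStep (d := 3) 1 (Lc ^ (k + 1)) κ' u' κ cc
              * contourSumAdj (Lc ^ (k + 1)) (fun l y => wΦ (N := Lc ^ (k + 1)) (d := 3) l β (y - z')) κ cc)|
        ≤ K₁ * Z₁ * ϑ ^ k := by
    intro κ' u' α x' β z'
    have h := hT rr hrr k κ' u' α x' β z'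
    rw [pow_pow_twelve, pow_pow_twelve] at h
    exact h.trans (geo hϑ₁0 h1 hK₁ hZ₁0 (exp_spread_le_one hκ₁.le _ _) (Real.exp_pos _).le)
  have bM : ∀ (κ' : Fin (3 + 1)) (u' : Site (3 + 1)) (α : Fin (3 + 1)) (x' : Site (3 + 1)) (β : Fin (3 + 1)) (z' : Site (3 + 1)),
      |(Lc : ℝ) ^ (12 * (k + 2)) *
          (∑' x : Site (3 + 1), ∑ κ,
            ((Psi (toSite rr) Lc 0 (k + 1) (delta1 α x') - bmGaugeAt (toSite rr) (respStep (d := 3) 1 (Lc ^ (k + 2)) α x') Lc) x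
              + (Psi (toSite rr) Lc 0 (k + 1) (delta1 α x') - bmGaugeAt (toSite rr) (respStep (d := 3) 1 (Lc ^ (k + 2)) α x') Lc) (x + unitVec κ)) / 2
              * respStep (d := 3) 1 (Lc ^ (k + 2)) κ' u' κ x
              * contourSumAdj (Lc ^ (k + 2)) (fun l y => wΦ (N := Lc ^ (k + 2)) (d := 3) l β (y - z')) κ x)
          - (Lc : ℝ) ^ (12 * (k + 1)) *
          (∑' cc : Site (3 + 1), ∑ κ,
            ((Psi (toSite rr) Lc 0 k (delta1 α x') - bmGaugeAt (toSite rr) (respStep (d := 3) 1 (Lc ^ (k + 1)) α x') Lc) cc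
              + (Psi (toSite rr) Lc 0 k (delta1 α x') - bmGaugeAt (toSite rr) (respStep (d := 3) 1 (Lc ^ (k + 1)) α x') Lc) (cc + unitVec κ)) / 2
              * respStep (d := 3) 1 (Lc ^ (k + 1)) κ' u' κ cc
              * contourSumAdj (Lc ^ (k + 1)) (fun l y => wΦ (N := Lc ^ (k + 1)) (d := 3) l β (y - z')) κ cc)|
        ≤ K₂ * Z₂ * ϑ ^ k := by
    intro κ' u' α x' β z'
    have h := hM rr hrr k κ' u' α x' β z'
    rw [pow_pow_twelve, pow_pow_twelve] at h
    exact h.trans (geo hϑ₂0 h2 hK₂ hZ₂0 (exp_spread_le_one hκ₂.le _ _) (Real.exp_pos _).le)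
  have bS : ∀ (κ' : Fin (3 + 1)) (u' : Site (3 + 1)) (α : Fin (3 + 1)) (x' : Site (3 + 1)) (β : Fin (3 + 1)) (z' : Site (3 + 1)),
      |(Lc : ℝ) ^ (12 * (k + 2)) *
          (∑' x : Site (3 + 1), ∑ κ,
            (Psi (toSite rr) Lc 0 (k + 1) (delta1 α x') - bmGaugeAt (toSite rr) (respStep (d := 3) 1 (Lc ^ (k + 2)) α x') Lc) x
              * respStep (d := 3) 1 (Lc ^ (k + 2)) κ' u' κ x
              * contourSumAdj (Lc ^ (k + 2)) (fun l y => wΦ (N := Lc ^ (k + 2)) (d := 3) l β (y - z')) κ x)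
          - (Lc : ℝ) ^ (12 * (k + 1)) *
          (∑' cc : Site (3 + 1), ∑ κ,
            (Psi (toSite rr) Lc 0 k (delta1 α x') - bmGaugeAt (toSite rr) (respStep (d := 3) 1 (Lc ^ (k + 1)) α x') Lc) cc
              * respStep (d := 3) 1 (Lc ^ (k + 1)) κ' u' κ cc
              * contourSumAdj (Lc ^ (k + 1)) (fun l y => wΦ (N := Lc ^ (k + 1)) (d := 3) l β (y - z')) κ cc)|
        ≤ K₃ * Z₃ * ϑ ^ k := by
    intro κ' u' α x' β z'
    have h := hS rr hrr k κ' u' α x' β z'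
    rw [pow_pow_twelve, pow_pow_twelve] at h
    exact h.trans (geo hϑ₃0 h3 hK₃ hZ₃0 (exp_spread_le_one hκ₃.le _ _) (Real.exp_pos _).le)
  -- the P-atom letters, summed over the direction
  have card4 : (((Finset.univ : Finset (Fin (3 + 1))).card : ℕ) : ℝ) = 4 := by
    rw [Finset.card_univ, Fintype.card_fin]; norm_num
  have bPt : ∀ (μt : Fin (3 + 1)) (zt : Site (3 + 1)) (μ₁ : Fin (3 + 1)) (z₁ : Site (3 + 1)) (μ₂ : Fin (3 + 1)) (z₂ : Site (3 + 1)),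
      |(Lc : ℝ) ^ (12 * (k + 2)) * (∑ κ : Fin (3 + 1), ∑' v : Site (3 + 1),
            contourSumAdj (Lc ^ (k + 2)) (fun κ' y => wΦ (N := Lc ^ (k + 2)) κ' μt (y - zt)) κ v
            * (Psi (toSite rr) Lc 0 (k + 1) (delta1 μ₁ z₁) (v + unitVec κ) - bmGaugeAt (toSite rr) (respStep (d := 3) 1 (Lc ^ (k + 2)) μ₁ z₁) Lc (v + unitVec κ))
            * ((Psi (toSite rr) Lc 0 (k + 1) (delta1 μ₂ z₂) (v + unitVec κ) - bmGaugeAt (toSite rr) (respStep (d := 3) 1 (Lc ^ (k + 2)) μ₂ z₂) Lc (v + unitVec κ))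
              - (Psi (toSite rr) Lc 0 (k + 1) (delta1 μ₂ z₂) v - bmGaugeAt (toSite rr) (respStep (d := 3) 1 (Lc ^ (k + 2)) μ₂ z₂) Lc v)))
          - (Lc : ℝ) ^ (12 * (k + 1)) * (∑ κ : Fin (3 + 1), ∑' w : Site (3 + 1),
            contourSumAdj (Lc ^ (k + 1)) (fun κ' y => wΦ (N := Lc ^ (k + 1)) κ' μt (y - zt)) κ w
            * (Psi (toSite rr) Lc 0 k (delta1 μ₁ z₁) (w + unitVec κ) - bmGaugeAt (toSite rr) (respStep (d := 3) 1 (Lc ^ (k + 1)) μ₁ z₁) Lc (w + unitVec κ))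
            * ((Psi (toSite rr) Lc 0 k (delta1 μ₂ z₂) (w + unitVec κ) - bmGaugeAt (toSite rr) (respStep (d := 3) 1 (Lc ^ (k + 1)) μ₂ z₂) Lc (w + unitVec κ))
              - (Psi (toSite rr) Lc 0 k (delta1 μ₂ z₂) w - bmGaugeAt (toSite rr) (respStep (d := 3) 1 (Lc ^ (k + 1)) μ₂ z₂) Lc w)))|
        ≤ 4 * K₄ * ϑ ^ k := by
    intro μt zt μ₁ z₁ μ₂ z₂
    have h := abs_mul_sum_sub_le (Finset.univ : Finset (Fin (3 + 1))) ((Lc : ℝ) ^ (12 * (k + 1))) ((Lc : ℝ) ^ (12 * (k + 2)))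
      (fun κ => ∑' w : Site (3 + 1),
            contourSumAdj (Lc ^ (k + 1)) (fun κ' y => wΦ (N := Lc ^ (k + 1)) κ' μt (y - zt)) κ w
            * (Psi (toSite rr) Lc 0 k (delta1 μ₁ z₁) (w + unitVec κ) - bmGaugeAt (toSite rr) (respStep (d := 3) 1 (Lc ^ (k + 1)) μ₁ z₁) Lc (w + unitVec κ))
            * ((Psi (toSite rr) Lc 0 k (delta1 μ₂ z₂) (w + unitVec κ) - bmGaugeAt (toSite rr) (respStep (d := 3) 1 (Lc ^ (k + 1)) μ₂ z₂) Lc (w + unitVec κ))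
              - (Psi (toSite rr) Lc 0 k (delta1 μ₂ z₂) w - bmGaugeAt (toSite rr) (respStep (d := 3) 1 (Lc ^ (k + 1)) μ₂ z₂) Lc w)))
      (fun κ => ∑' v : Site (3 + 1),
            contourSumAdj (Lc ^ (k + 2)) (fun κ' y => wΦ (N := Lc ^ (k + 2)) κ' μt (y - zt)) κ v
            * (Psi (toSite rr) Lc 0 (k + 1) (delta1 μ₁ z₁) (v + unitVec κ) - bmGaugeAt (toSite rr) (respStep (d := 3) 1 (Lc ^ (k + 2)) μ₁ z₁) Lc (v + unitVec κ))
            * ((Psi (toSite rr) Lc 0 (k + 1) (delta1 μ₂ z₂) (v + unitVec κ) - bmGaugeAt (toSite rr) (respStep (d := 3) 1 (Lc ^ (k + 2)) μ₂ z₂) Lc (v + unitVec κ))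
              - (Psi (toSite rr) Lc 0 (k + 1) (delta1 μ₂ z₂) v - bmGaugeAt (toSite rr) (respStep (d := 3) 1 (Lc ^ (k + 2)) μ₂ z₂) Lc v)))
      (b := K₄ * ϑ ^ k)
      (fun κ _ => (hPt rr hrr k μt zt μ₁ z₁ μ₂ z₂ κ).trans (geoP hϑ₄0 h4 hK₄ (exp_spread_le_one hκ₄.le _ _) (Real.exp_pos _).le))
    rw [card4] at h
    simpa only [mul_assoc] using h
  have bPm : ∀ (μt : Fin (3 + 1)) (zt : Site (3 + 1)) (μ₁ : Fin (3 + 1)) (z₁ : Site (3 + 1)) (μ₂ : Fin (3 + 1)) (z₂ : Site (3 + 1)),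
      |(Lc : ℝ) ^ (12 * (k + 2)) * (∑ κ : Fin (3 + 1), ∑' v : Site (3 + 1),
            contourSumAdj (Lc ^ (k + 2)) (fun κ' y => wΦ (N := Lc ^ (k + 2)) κ' μt (y - zt)) κ v
            * (((Psi (toSite rr) Lc 0 (k + 1) (delta1 μ₁ z₁) v - bmGaugeAt (toSite rr) (respStep (d := 3) 1 (Lc ^ (k + 2)) μ₁ z₁) Lc v)
              + (Psi (toSite rr) Lc 0 (k + 1) (delta1 μ₁ z₁) (v + unitVec κ) - bmGaugeAt (toSite rr) (respStep (d := 3) 1 (Lc ^ (k + 2)) μ₁ z₁) Lc (v + unitVec κ))) / 2)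
            * ((Psi (toSite rr) Lc 0 (k + 1) (delta1 μ₂ z₂) (v + unitVec κ) - bmGaugeAt (toSite rr) (respStep (d := 3) 1 (Lc ^ (k + 2)) μ₂ z₂) Lc (v + unitVec κ))
              - (Psi (toSite rr) Lc 0 (k + 1) (delta1 μ₂ z₂) v - bmGaugeAt (toSite rr) (respStep (d := 3) 1 (Lc ^ (k + 2)) μ₂ z₂) Lc v)))
          - (Lc : ℝ) ^ (12 * (k + 1)) * (∑ κ : Fin (3 + 1), ∑' w : Site (3 + 1),
            contourSumAdj (Lc ^ (k + 1)) (fun κ' y => wΦ (N := Lc ^ (k + 1)) κ' μt (y - zt)) κ w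
            * (((Psi (toSite rr) Lc 0 k (delta1 μ₁ z₁) w - bmGaugeAt (toSite rr) (respStep (d := 3) 1 (Lc ^ (k + 1)) μ₁ z₁) Lc w)
              + (Psi (toSite rr) Lc 0 k (delta1 μ₁ z₁) (w + unitVec κ) - bmGaugeAt (toSite rr) (respStep (d := 3) 1 (Lc ^ (k + 1)) μ₁ z₁) Lc (w + unitVec κ))) / 2)
            * ((Psi (toSite rr) Lc 0 k (delta1 μ₂ z₂) (w + unitVec κ) - bmGaugeAt (toSite rr) (respStep (d := 3) 1 (Lc ^ (k + 1)) μ₂ z₂) Lc (w + unitVec κ))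
              - (Psi (toSite rr) Lc 0 k (delta1 μ₂ z₂) w - bmGaugeAt (toSite rr) (respStep (d := 3) 1 (Lc ^ (k + 1)) μ₂ z₂) Lc w)))|
        ≤ 4 * K₅ * ϑ ^ k := by
    intro μt zt μ₁ z₁ μ₂ z₂
    have h := abs_mul_sum_sub_le (Finset.univ : Finset (Fin (3 + 1))) ((Lc : ℝ) ^ (12 * (k + 1))) ((Lc : ℝ) ^ (12 * (k + 2)))
      (fun κ => ∑' w : Site (3 + 1),
            contourSumAdj (Lc ^ (k + 1)) (fun κ' y => wΦ (N := Lc ^ (k + 1)) κ' μt (y - zt)) κ w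
            * (((Psi (toSite rr) Lc 0 k (delta1 μ₁ z₁) w - bmGaugeAt (toSite rr) (respStep (d := 3) 1 (Lc ^ (k + 1)) μ₁ z₁) Lc w)
              + (Psi (toSite rr) Lc 0 k (delta1 μ₁ z₁) (w + unitVec κ) - bmGaugeAt (toSite rr) (respStep (d := 3) 1 (Lc ^ (k + 1)) μ₁ z₁) Lc (w + unitVec κ))) / 2)
            * ((Psi (toSite rr) Lc 0 k (delta1 μ₂ z₂) (w + unitVec κ) - bmGaugeAt (toSite rr) (respStep (d := 3) 1 (Lc ^ (k + 1)) μ₂ z₂) Lc (w + unitVec κ))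
              - (Psi (toSite rr) Lc 0 k (delta1 μ₂ z₂) w - bmGaugeAt (toSite rr) (respStep (d := 3) 1 (Lc ^ (k + 1)) μ₂ z₂) Lc w)))
      (fun κ => ∑' v : Site (3 + 1),
            contourSumAdj (Lc ^ (k + 2)) (fun κ' y => wΦ (N := Lc ^ (k + 2)) κ' μt (y - zt)) κ v
            * (((Psi (toSite rr) Lc 0 (k + 1) (delta1 μ₁ z₁) v - bmGaugeAt (toSite rr) (respStep (d := 3) 1 (Lc ^ (k + 2)) μ₁ z₁) Lc v)
              + (Psi (toSite rr) Lc 0 (k + 1) (delta1 μ₁ z₁) (v + unitVec κ) - bmGaugeAt (toSite rr) (respStep (d := 3) 1 (Lc ^ (k + 2)) μ₁ z₁) Lc (v + unitVec κ))) / 2)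
            * ((Psi (toSite rr) Lc 0 (k + 1) (delta1 μ₂ z₂) (v + unitVec κ) - bmGaugeAt (toSite rr) (respStep (d := 3) 1 (Lc ^ (k + 2)) μ₂ z₂) Lc (v + unitVec κ))
              - (Psi (toSite rr) Lc 0 (k + 1) (delta1 μ₂ z₂) v - bmGaugeAt (toSite rr) (respStep (d := 3) 1 (Lc ^ (k + 2)) μ₂ z₂) Lc v)))
      (b := K₅ * ϑ ^ k)
      (fun κ _ => (hPm rr hrr k μt zt μ₁ z₁ μ₂ z₂ κ).trans (geoP hϑ₅0 h5 hK₅ (exp_spread_le_one hκ₅.le _ _) (Real.exp_pos _).le))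
    rw [card4] at h
    simpa only [mul_assoc] using h
  -- the two towers as atoms
  have hc' := contact_eq_atoms hLc hrr (k + 1) κ₁' u' x' z' α β
  rw [show k + 1 + 1 = k + 2 from rfl] at hc'
  rw [hc', contact_eq_atoms hLc hrr k κ₁' u' x' z' α β]
  refine (abs_comb_le _ _ _ _ _ _ _ _ _ _ _ _ _ _ _ _ _ _ _ _).trans ?_
  have e1 := bT κ₁' u' α x' β z'
  have e2 := bPt β z' α x' κ₁' u'
  have e3 := bM β z' α x' κ₁' u'
  have e4 := bPm κ₁' u' α x' β z'
  have e5 := bT κ₁' u' β z' α x'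
  have e6 := bPt α x' β z' κ₁' u'
  have e7 := bM α x' β z' κ₁' u'
  have e8 := bS β z' κ₁' u' α x'
  have e9 := bS α x' κ₁' u' β z'
  have hsum := add_le_add (add_le_add (add_le_add (add_le_add (add_le_add (add_le_add (add_le_add (add_le_add e1 e2) e3) e4) e5) e6) e7) e8) e9
  refine (mul_le_mul_of_nonneg_left hsum (by norm_num : (0 : ℝ) ≤ 1 / 2)).trans (le_of_eq ?_)
  rw [hK]
  ring

end Three

end Summit.QuantumFields.BalabanUV.Beta.GAN24.ContactCauchyAssembly

end
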